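import Summits.RiemannHypothesis.RiemannHypothesis.Theorems.LiPrimeEchoDefs
import HarnessLib

/-!
# RiemannHypothesis / LI column — vocabulary PART K and the rung leaf «Li TAIL–LAGUERRE LAW» (RH-FREE, all `n`)

Cell `pub/rh-li` (D-0040/D-0059/D-0061), theory round 7 (gen 9; dossier `theory/route/r7/README-R7.md`), successor of
PART D (`Theorems/LiPrimeEchoDefs.lean`, leaf `LiZeroWindowEcho`, route `Theses/LiPrimeEcho.lean` CLOSED·proved).
Statement-only module (`def`s + `@[conjecture]` targets + PROVED glue; no `sorry`, no axioms).

THE LAW (leaf `LiZeroTailLaguerre`).  Write `z_ρ = 1 − 1/ρ`, `θ(t) = 2 arctan(1/2t)` (`liZeroAngle`), `ϑ'` =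
`liGammaDensity`, and let `L¹_{n−1}(y) = Σ_{j<n} C(n, j+1) (−y)^j / j!` be the associated Laguerre polynomial
(`liLaguerreOne n y`).  For every fixed `c > 0` such that no prime power `m` has `log m = 1/c²`, and all `n ≥ 2`,
`| Σ_{|Im ρ| > c√n} Re m_ρ (1 − z_ρ^n) − (2/π) ∫_{c√n}^∞ (1 − cos nθ(t)) ϑ'(t) dt + Σ_{2 ≤ m ≤ e^{1/c²}} (Λ(m)/m) L¹_{n−1}(log m) |
   ≤ C_c log² n`.
In words: THE ZEROS ABOVE HEIGHT `c√n`, summed with the Li weight and compared with their Riemann–von Mangoldt mean,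
EQUAL MINUS THE EXACT BOMBIERI–LAGARIAS/COFFEY ARITHMETIC-FORMULA TERMS OF THE PRIME POWERS BELOW `e^{1/c²}`
(`liCoffeyTerm m n = (Λ(m)/m) L¹_{n−1}(log m)`; the arithmetic formula, PROVED in tree as `Coffey2005_thm1_holds`, is
`liOscPart n = lim_N {[1 − L_n(log N)] − Σ_{m ≤ N} liCoffeyTerm m n}`).  The cutoff HEIGHT `T` and the prime TRUNCATION
`x` are dual, `x = e^{n/T²}`: as `c` decreases through `c_m = (log m)^{−1/2}` (`1.2011, 0.9542, 0.8493, 0.7884, 0.7169, …`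
for `m = 2, 3, 4, 5, 7, …`) the tail RELEASES the term of `m` WHOLE; for `c > 1.2011` the sum is empty (TAIL SILENCE,
companion `LiZeroTailSilent`), for `c = 1` it is the single term of `m = 2`, whose Fejér asymptotic is the chirp
`−liPrimeEcho 2 n = −A₂ n^{1/4} cos(2√(n log 2) + π/4)` of PART D (companions `LiCoffeyTermFejer`, `LiZeroTailEcho`).
Differencing two cutoffs gives the general WINDOW law `LiZeroWindowEchoes` (T3e) with its exact main terms.

RH-FREE FOR ALL `n` (rule 4 label): `liZeroTail n T := λ_n − Re Σ_{ρ ∈ liZeroBox T} m_ρ (1 − z_ρ^n)` subtracts a FINITE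
box sum from `keiperLiCoeff n`; by Bombieri–Lagarias (`keiperLiCoeff_eq_zero_sum_holds`, PROVED) it is the limit of the
window sums `Σ_{T < |Im ρ| ≤ Y} Re m_ρ (1 − z_ρ^n)`, `Y → ∞`, in which every zero is summed WHATEVER ITS REAL PART with
a weight bounded by `1 + e^{1/(2c²)}` (`|z_ρ^n| ≤ (1 + 1/|Im ρ|²)^{n/2}`) and `Re(1 − z_ρ^n) = O(n²/|ρ|²)` beyond
`|ρ| ≍ n` (absolute convergence).  The truth value of the leaf does not depend on RH and nothing here bears on the truth
of RH; it is PROOF-OF-DATA and NOT height-buying.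

DATA (all certified inputs; nothing here is evidence for RH).  (1) ET2 TAIL SILENCE (rh-li-eng g3, kit j248301,
`data/li_tail_silence.tsv`, DATA.md §H): `D_tail(n;c) = liZeroTail − liSmoothTail` at 221 log-spaced `n ∈ [10³, 10⁷]`,
balls of radius `≤ 5.5e-10`: for `c ∈ {1.25, 1.5, 2, 3}` BOUNDED (band rms 0.7–2.3, sup ≤ 4.9, growth exponent ≤ 0.08);
for `c = 1.0` the full `+E₂` echo (`β = 0.93…1.19`).  (2) THE LAW ITSELF (theory g9, kit j255188, 2 c × 10 s,
`theory/route/r7/data/`): `R_L(n;c) := D_tail(n;c) + Σ_{m ≤ e^{1/c²}} liCoffeyTerm m n` over the same 221 `n` for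
`c ∈ {1.0, 1.07, 0.90, 0.80, 0.752, 0.66}` (released prime powers `{2}, {2}, {2,3}, {2,3,4}, {2,3,4,5}, {2,3,4,5,7,8,9}`):
band rms `0.8–2.2` (`3.3` in the top band at `c = 0.80`, which sits `0.012` from `c₅`), `max ≤ 4.8` (`6.2`), growth
exponents `−0.06 … +0.10` (an `n^{1/4}` law has `0.25`), means within `±0.7`, while the subtracted Laguerre sum grows
`1.7 → 11` (`c = 1`) and `5.6 → 27.6` (`c = 0.66`) like `n^{1/4}`; STEP-0: `D_tail(n;1)` recomputed = ET2's ball to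
`3.2e-11` at every `n`.  (3) eng-4 g3's LAGUERRE BRIDGE (memo `eng4/g3/MEMO-laguerre-bridge.md`, DATA.md N.12):
`∫_0^∞ 2(1 − cos nθ(t)) cos(ty) dt = π e^{−y/2} L¹_{n−1}(y)` checked at 45 pairs `(n, y)` to `1e-8`; (4) eng-4 g4's
PRIME-SIDE STAIRCASE (kit j254850, DATA.md N.13): the deficit of the Laguerre partial sum `lt_n − B_n(x)` sits on the
zero-side staircase level dual to `x` — the same law read from the prime side.  The typed `O(log² n)` is generous
(empirically `O(1)`: the sawtooth of single zeros crossing `c√n` plus the `S(t)` boundary term).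

MECHANISM (route `Theses/LiTailLaguerre.lean`; theory memo `TARGETS.md` §7.10 STEP F (gen 2) made exact by the bridge):
Bombieri's rectangle of PART D with the CO-WEIGHT `1 − F_n` on the HALF-STRIP `[−1/2, 3/2] × [T, ∞)` — the symmetrised
weight on the right edge is `2 − k_n(w)` (`liCoSymWeight`), which is `O(n²/|w|²)` beyond `|w| ≍ n` (the top edge
vanishes, every edge integral converges absolutely): `liZeroTail = liPolarTail + liGammaTail − liPrimeTail + liHorizTail`
at good heights (crux `LiTailContour`); the gamma piece shifted to `Re w = ½` IS `liSmoothTail` (`2 − k_n(½+it) =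
2(1 − cos nθ(t)) ≥ 0`; crux `LiGammaTailShift`, cost `O(log n)`); the horizontal edge is `O(log² n)` at a good height
(crux `LiTailHorizontal`); and in the prime piece `Σ_m Λ(m) m^{−3/2} ∫_T^∞ m^{−iy}(2 − k_n) dy` (absolutely convergent,
sum and integral exchangeable) every RELEASED `m` (`log m < n/T²`: stationary height `t₀(m) = √(n/log m)` above `T`) is
SHIFTED to the critical line, where the complete integral is the bridge identity `= π m^{−1/2} L¹_{n−1}(log m)` EXACTLY
and the missing piece `∫_0^T` is non-stationary (`O(1/gap)`), while every non-released `m` and the `F_n(w)`-half are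
non-stationary on `Re w = 3/2` (first-derivative test, summed absolutely against `Λ(m) m^{−3/2}`) — crux
`LiPrimeTailLaguerre` (DECIDING).  NO stationary-phase evaluation is needed anywhere: the `n^{1/4}` chirp is never
extracted, it lives inside `L¹_{n−1}(log m)`.  Sources: Bombieri–Lagarias 1999 Thm 1 (`keiperLiCoeff_eq_zero_sum`);
Coffey 2005 (Thm 1, eq. (122): `L¹_{n−1}` as an inverse Laplace transform); Lagarias 2007 §§3–4; Fejér 1909 / Perron 1921
/ Szegő Thm 8.22.1 (Laguerre asymptotics, used only by the companions); the PART D record for the window law.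

FENCES.  (i) RH-equivalent statements (`li_criterion_holds`; the full asymptotics of `λ_n`) are NOT targets here; the
law constrains `λ_n` only through the identity `λ_n = liZeroTail n T + (finite box sum)`, whose box sum has unbounded
weights at hypothetical off-line LOW zeros — it is a statement about the zeros of height `> c√n`, consistent with any
zero configuration obeying the known density theorems.  (ii) Companions below are typed targets of the family, NOT
items of the route; the PROVED glue records how they hang together.  (iii) `liLaguerreOne` is this column's name for
`L^{(1)}_{n−1}` (the tree has no Laguerre polynomials; `Literature.Analysis.Quadrature.laguerreOne` is an unrelated
quadrature rule).
-/

noncomputable section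

-- D-0017: `Summit.<S>.<S>.…` is the designed namespace of a single-problem summit.
set_option linter.dupNamespace false

open MeasureTheory intervalIntegral
open scoped ArithmeticFunction.vonMangoldt ComplexConjugate

namespace Summit.RiemannHypothesis.RiemannHypothesis.Theorems.LiTheory

open Literature.NumberTheory.LFunctions

/-! ## PART K — vocabulary of the tail–Laguerre law -/

/-- The associated Laguerre polynomial `L^{(1)}_{n−1}(y) = Σ_{j<n} C(n, j+1) (−y)^j / j!` (`= 0` for `n = 0`;
`L^{(1)}_0 = 1`, `L^{(1)}_1(y) = 2 − y`); Coffey's kernel: `Σ_{j=1}^n C(n,j) (−y)^{j−1}/(j−1)!`. -/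
def liLaguerreOne (n : ℕ) (y : ℝ) : ℝ :=
  ∑ j ∈ Finset.range n, ((n.choose (j + 1) : ℕ) : ℝ) * (-y) ^ j / (j.factorial : ℝ)

/-- The term of the prime power `m` in the Bombieri–Lagarias/Coffey arithmetic formula for `λ_n`:
`(Λ(m)/m) L^{(1)}_{n−1}(log m)` (so that `liOscPart n = lim_N {[1 − L_n(log N)] − Σ_{m≤N} liCoffeyTerm m n}`, Coffey 2005
(10)–(12); `= 0` unless `m` is a prime power).  Its Fejér asymptotic is `−liPrimeEcho m n + O_m(n^{−1/4})`. -/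
def liCoffeyTerm (m n : ℕ) : ℝ :=
  (Λ m : ℝ) / m * liLaguerreOne n (Real.log m)

/-- The Li ZERO TAIL above height `T`: `λ_n − Re Σ_{ρ ∈ liZeroBox T} m_ρ (1 − (1 − 1/ρ)^n)` — by Bombieri–Lagarias
(`keiperLiCoeff_eq_zero_sum_holds`) the limit `Y → ∞` of the window sums `Σ_{T < |Im ρ| ≤ Y} Re m_ρ (1 − z_ρ^n)` (all zeros,
with multiplicity, whatever their real part; absolutely convergent).  RH-free object. -/
def liZeroTail (n : ℕ) (T : ℝ) : ℝ :=
  keiperLiCoeff n - (∑ᶠ ρ ∈ liZeroBox T, (riemannZetaZeroOrder ρ : ℂ) * (1 - (1 - 1 / ρ) ^ n)).re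

/-- The SMOOTH counterpart of the tail: `(2/π) ∫_T^∞ (1 − cos nθ(t)) ϑ'(t) dt` (integrand `O(n² log t / t²)` beyond
`t ≍ n`; `(2/π)∫_0^∞ = liArchPart n`, ET2 H.1(iii) / T1b). -/
def liSmoothTail (n : ℕ) (T : ℝ) : ℝ :=
  2 / Real.pi * ∫ t in Set.Ioi T, liWindowWeight n t * liGammaDensity t

/-! ## PART K — half-strip contour vocabulary (the pieces the route's cruxes speak about) -/

/-- The symmetrised CO-WEIGHT `2 − k_n(w) = (1 − F_n(w)) + (1 − F_n(1 − w))` (`= 2(1 − cos nθ(t)) ≥ 0` on `Re w = ½`;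
`O(n²/|w|²)` for `|w| ≫ n`). -/
def liCoSymWeight (n : ℕ) (w : ℂ) : ℂ := 2 - liSymWeight n w

/-- POLAR piece of the right edge of the half-strip: the co-weight against `1/w + 1/(w − 1)` on `3/2 + iy`, `y > T`. -/
def liPolarTail (n : ℕ) (T : ℝ) : ℝ :=
  1 / Real.pi *
    (∫ y in Set.Ioi T, (1 / liRightPt y + 1 / (liRightPt y - 1)) * liCoSymWeight n (liRightPt y)).re

/-- GAMMA piece of the right edge of the half-strip: the co-weight against `−½ log π + ½ ψ(w/2)`. -/
def liGammaTail (n : ℕ) (T : ℝ) : ℝ :=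
  1 / Real.pi *
    (∫ y in Set.Ioi T, (-(Real.log Real.pi : ℂ) / 2 + 1 / 2 * Complex.digamma (liRightPt y / 2)) *
      liCoSymWeight n (liRightPt y)).re

/-- PRIME piece of the right edge of the half-strip: the co-weight against `L(Λ, w) = Σ_m Λ(m) m^{−w}` (enters `ξ'/ξ`
with a MINUS; absolutely convergent). -/
def liPrimeTail (n : ℕ) (T : ℝ) : ℝ :=
  1 / Real.pi *
    (∫ y in Set.Ioi T, LSeries (fun m ↦ (Λ m : ℂ)) (liRightPt y) * liCoSymWeight n (liRightPt y)).re

/-- The bottom (horizontal) edge of the half-strip: `(1/π) Im ∫_{−1/2}^{3/2} ξ'/ξ(x + iT) (1 − F_n(x + iT)) dx`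
(`= (1/π) Im ∫ ξ'/ξ dx − liHorizTerm n T`; the first piece is `−2S(T) + O(1)`). -/
def liHorizTail (n : ℕ) (T : ℝ) : ℝ :=
  1 / Real.pi *
    (∫ x in (-(1 / 2 : ℝ))..(3 / 2 : ℝ),
      logDeriv riemannXi (x + T * Complex.I) * (1 - liWeight n (x + T * Complex.I))).im

/-! ## The rung leaf -/

/-- **RUNG LEAF «Li TAIL–LAGUERRE LAW» (RH-FREE for all `n`; PROOF-OF-DATA; NOT height-buying)** — round 7 of the LI
column.  For every fixed `c > 0` with `log m ≠ 1/c²` for all prime powers `m` (no stationary height on the cut):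
`|liZeroTail n (c√n) − liSmoothTail n (c√n) + Σ_{2 ≤ m ≤ ⌊e^{1/c²}⌋} liCoffeyTerm m n| ≤ C_c log² n` for all `n ≥ 2`
(`liCoffeyTerm m n = 0` unless `m` is a prime power; `m = ⌊e^{1/c²}⌋` with `log m = 1/c²` is excluded by the hypothesis).
DATA: kit j255188 (six cutoffs, up to seven released prime powers, 221 certified `n ∈ [10³, 10⁷]`: bounded, growth
exponent ≤ 0.10) on top of ET2 j248301; see the module docstring.  KILL: a certified `n`-range on which
`|liZeroTail − liSmoothTail + Σ liCoffeyTerm| / n^{1/4}` does not tend to `0` for an admissible `c`, or a normalisation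
mismatch in the bridge identity (`π e^{−y/2}`, index `n − 1`).  WHAT THIS IS NOT: not evidence for RH, not RH-sensitive,
not a positivity statement. [mechanism: Bombieri–Lagarias contour + Coffey (122); statement new] -/
@[conjecture] def LiZeroTailLaguerre : Prop :=
  ∀ c : ℝ, 0 < c → (∀ m : ℕ, 2 ≤ m → (Λ m : ℝ) ≠ 0 → Real.log m ≠ 1 / c ^ 2) →
    ∃ C : ℝ, ∀ n : ℕ, 2 ≤ n →
      |liZeroTail n (c * Real.sqrt n) - liSmoothTail n (c * Real.sqrt n)
          + ∑ m ∈ Finset.Icc 2 ⌊Real.exp (1 / c ^ 2)⌋₊, liCoffeyTerm m n|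
        ≤ C * Real.log n ^ 2

/-! ## Companions of the leaf (typed targets of the family — NOT route items) and PROVED glue -/

/-- TAIL SILENCE (T3f₀; RH-FREE; the empty instance): for `c ≥ 5/4` (`> 1.2011 = (log 2)^{−1/2}`) no prime power is
released and the tail IS its smooth counterpart up to `O_c(log² n)`.  DATA: ET2 j248301, `c ∈ {1.25, 1.5, 2, 3}`:
band rms 0.7–2.3, sup ≤ 4.9 over `n ∈ [10³, 10⁷]`. -/
@[conjecture] def LiZeroTailSilent : Prop :=
  ∀ c : ℝ, 5 / 4 ≤ c → ∃ C : ℝ, ∀ n : ℕ, 2 ≤ n →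
    |liZeroTail n (c * Real.sqrt n) - liSmoothTail n (c * Real.sqrt n)| ≤ C * Real.log n ^ 2

/-- Glue (PROVED): the leaf gives tail silence (for `c ≥ 5/4`, `e^{1/c²} ≤ e^{16/25} < 2`: the sum is empty). -/
theorem liZeroTailSilent_of (h : LiZeroTailLaguerre) : LiZeroTailSilent := by
  intro c hc
  have hc0 : 0 < c := by linarith
  have hcsq : (25 : ℝ) / 16 ≤ c ^ 2 := by nlinarith
  have hc2 : 1 / c ^ 2 ≤ 16 / 25 := by
    have := one_div_le_one_div_of_le (by norm_num : (0 : ℝ) < 25 / 16) hcsq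
    simpa using this
  have hlog2 : (16 : ℝ) / 25 < Real.log 2 := by
    have := Real.log_two_gt_d9; norm_num at this ⊢; linarith
  have hlt : 1 / c ^ 2 < Real.log 2 := lt_of_le_of_lt hc2 hlog2
  have hedge : ∀ m : ℕ, 2 ≤ m → (Λ m : ℝ) ≠ 0 → Real.log m ≠ 1 / c ^ 2 := by
    intro m hm _ heq
    have h2m : Real.log 2 ≤ Real.log m :=
      Real.log_le_log (by norm_num) (by exact_mod_cast hm)
    linarith
  obtain ⟨C, hC⟩ := h c hc0 hedge
  refine ⟨C, fun n hn ↦ ?_⟩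
  have key := hC n hn
  have hfl : ⌊Real.exp (1 / c ^ 2)⌋₊ < 2 := by
    rw [Nat.floor_lt (Real.exp_pos _).le]
    have := (Real.lt_log_iff_exp_lt (by norm_num : (0 : ℝ) < 2)).1 hlt
    exact_mod_cast this
  have hsum : (∑ m ∈ Finset.Icc 2 ⌊Real.exp (1 / c ^ 2)⌋₊, liCoffeyTerm m n) = 0 := by
    rw [Finset.Icc_eq_empty (by omega), Finset.sum_empty]
  rwa [hsum, add_zero] at key

/-- FEJÉR ASYMPTOTIC of the Coffey terms (classical: Fejér 1909, Perron 1921, Szegő *Orthogonal Polynomials* Thm 8.22.1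
for `α = 1`; here with an explicit `O(n^{−1/4})`): `e^{−y/2} L¹_{n−1}(y) = π^{−1/2} y^{−3/4} n^{1/4} cos(2√(ny) − 3π/4)
+ O_y(n^{−1/4})`, i.e. `liCoffeyTerm m n = −liPrimeEcho m n + O_m(n^{−1/4})`.  Support-size target (stationary phase
of the bridge integral, `weightedStationaryPhase_sharp`); NOT used by the leaf or its route. -/
@[conjecture] def LiCoffeyTermFejer : Prop :=
  ∀ m : ℕ, 2 ≤ m → ∃ C : ℝ, ∀ n : ℕ, 1 ≤ n →
    |liCoffeyTerm m n + liPrimeEcho m n| ≤ C * (n : ℝ) ^ (-(1 / 4 : ℝ))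

/-- TAIL ECHO (T3f; RH-FREE; the instance `c = 1`): the zeros above `√n` carry the FULL echo of the prime `2` with the
sign PLUS: `|liZeroTail n √n − liSmoothTail n √n − E₂(n)| ≤ C log² n`.  DATA: ET2 j248301, `c = 1.0`: `corr(D, +E₂) =
0.88 … 0.99`, `β = 0.93 … 1.19`, `rms(D − E₂) ≤ 2`. -/
@[conjecture] def LiZeroTailEcho : Prop :=
  ∃ C : ℝ, ∀ n : ℕ, 2 ≤ n →
    |liZeroTail n (Real.sqrt n) - liSmoothTail n (Real.sqrt n) - liPrimeEcho 2 n| ≤ C * Real.log n ^ 2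

/-- Glue (PROVED): the leaf at `c = 1` (the single released prime power `m = 2`, `⌊e⌋ = 2`) and the Fejér asymptotic give
the tail echo. -/
theorem liZeroTailEcho_of (h : LiZeroTailLaguerre) (hF : LiCoffeyTermFejer) : LiZeroTailEcho := by
  have hedge : ∀ m : ℕ, 2 ≤ m → (Λ m : ℝ) ≠ 0 → Real.log m ≠ 1 / (1 : ℝ) ^ 2 := by
    intro m hm _
    rw [one_pow, div_one]
    rcases Nat.lt_or_ge m 3 with h3 | h3
    · have hm2 : m = 2 := by omega
      subst hm2
      have := Real.log_two_lt_d9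
      push_cast
      norm_num at this ⊢; linarith
    · have h3' : (3 : ℝ) ≤ m := by exact_mod_cast h3
      have h1 : 1 < Real.log m := by
        refine (Real.lt_log_iff_exp_lt (by positivity)).2 (lt_of_lt_of_le ?_ h3')
        have := Real.exp_one_lt_d9
        norm_num at this ⊢; linarith
      exact ne_of_gt h1
  obtain ⟨C, hC⟩ := h 1 one_pos hedge
  obtain ⟨C', hC'⟩ := hF 2 le_rfl
  refine ⟨C + |C'| / Real.log 2 ^ 2, fun n hn ↦ ?_⟩
  have key := hC n hn
  rw [one_mul, floor_exp_one_div_one_sq, Finset.Icc_self, Finset.sum_singleton] at key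
  have hF2 := hC' n (by omega)
  have h2 : 0 < Real.log 2 := Real.log_pos (by norm_num)
  have hlog : Real.log 2 ≤ Real.log n := Real.log_le_log (by norm_num) (by exact_mod_cast hn)
  have hlogpos : 0 < Real.log n := h2.trans_le hlog
  have hn0 : (0 : ℝ) < n := by exact_mod_cast (show 0 < n by omega)
  have hpow : (n : ℝ) ^ (-(1 / 4 : ℝ)) ≤ 1 :=
    Real.rpow_le_one_of_one_le_of_nonpos (by exact_mod_cast (show 1 ≤ n by omega)) (by norm_num)
  have hpow0 : 0 ≤ (n : ℝ) ^ (-(1 / 4 : ℝ)) := Real.rpow_nonneg hn0.le _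
  have hF2' : |liCoffeyTerm 2 n + liPrimeEcho 2 n| ≤ |C'| / Real.log 2 ^ 2 * Real.log n ^ 2 := by
    calc |liCoffeyTerm 2 n + liPrimeEcho 2 n| ≤ C' * (n : ℝ) ^ (-(1 / 4 : ℝ)) := hF2
      _ ≤ |C'| * (n : ℝ) ^ (-(1 / 4 : ℝ)) := mul_le_mul_of_nonneg_right (le_abs_self _) hpow0
      _ ≤ |C'| * 1 := mul_le_mul_of_nonneg_left hpow (abs_nonneg _)
      _ = |C'| / Real.log 2 ^ 2 * (Real.log 2 * Real.log 2) := by field_simp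
      _ ≤ |C'| / Real.log 2 ^ 2 * (Real.log n * Real.log n) := by
          apply mul_le_mul_of_nonneg_left _ (by positivity)
          exact mul_le_mul hlog hlog h2.le hlogpos.le
      _ = |C'| / Real.log 2 ^ 2 * Real.log n ^ 2 := by ring
  calc |liZeroTail n (Real.sqrt n) - liSmoothTail n (Real.sqrt n) - liPrimeEcho 2 n|
        = |(liZeroTail n (Real.sqrt n) - liSmoothTail n (Real.sqrt n) + liCoffeyTerm 2 n)
            - (liCoffeyTerm 2 n + liPrimeEcho 2 n)| := by ring_nf
    _ ≤ |liZeroTail n (Real.sqrt n) - liSmoothTail n (Real.sqrt n) + liCoffeyTerm 2 n|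
          + |liCoffeyTerm 2 n + liPrimeEcho 2 n| := abs_sub _ _
    _ ≤ C * Real.log n ^ 2 + |C'| / Real.log 2 ^ 2 * Real.log n ^ 2 := add_le_add key hF2'
    _ = (C + |C'| / Real.log 2 ^ 2) * Real.log n ^ 2 := by ring

end Summit.RiemannHypothesis.RiemannHypothesis.Theorems.LiTheory

end
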